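import Summits.AtomisticToContinuum.Crystallization.Theorems.ThreeConeCertificateSlackRigidityPricedFloorsS3Defs2
import Summits.AtomisticToContinuum.Crystallization.Theorems.ThreeConeCertificateSlackRigidityPricedFloorsRootCake
import Summits.AtomisticToContinuum.Crystallization.Theorems.ThreeConeCertificateSlackRigidityPricedFloorsReadoff
import HarnessLib

/-!
# `SlackRigidity` (stmt-AtomisticToContinuum-11960), line `priced-floors-palm-exactification`, stub S3
# (`stub_layeredMeanSelection`), fault identification package (FI2): the competitor energy of ideal
# fcc data is at least `2e*`

Lead c19, worker W14.  For normal-form layering data `e = (T, a, s, z)` the COMPETITOR ENERGY is the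
root layer-cake energy of the restacked data `(a, alternatingHagg, z)` (same heights, alternating word):

  `HcE e = Φ₀(a) + Σ'_{m ≠ 0} Φ(a, z m, L_alt m)`.

If `e` is IDEAL FCC DATA (`IsFccData e`: constant word steps and ideal spacings `z (m+1) − z m = a √(2/3)`),
then `z m = m · a √(2/3)` and the restacked data present the hcp crystal `hcpStacking a (a √(2/3))`
(`SlackRigidityPricedFloorsReadoff.layeredSet_eq_image`), so by the root layer cake
(`SlackRigidityPricedFloorsRootCake.two_mul_rootEnergy_eq`) and vertex-transitivity of hcp
(`SlackRigidityPricedFloorsReadoff.rootEnergy_hcpStacking`) `HcE e = 2 e(hcp a h) ≥ 2 e*`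
(`ChargedEnergyGapNegative.eStar_le`).  Registered sub-goal `lms_competitor_ge_of_fcc`.  All `[folklore]`.
-/

noncomputable section

open MeasureTheory Filter Set
open scoped ENNReal BigOperators Topology

namespace Summit.AtomisticToContinuum.Crystallization.Theorems.SlackRigidityPricedFloorsFaultIdent

open Literature.Probability.Process
open Literature.MathematicalPhysics.StatisticalMechanics
open Summit.AtomisticToContinuum.Crystallization.Theorems.SlackRigidityPricedFloors
open Summit.AtomisticToContinuum.Crystallization.Theorems.SlackRigidityPricedFloorsRootCake
open Summit.AtomisticToContinuum.Crystallization.Theorems.SlackRigidityPricedFloorsReadoff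
open Summit.AtomisticToContinuum.Crystallization.Theorems.MinimiserShells.Negative.LoadBearing (eStar)

/-- The heights of ideal fcc data with `z 0 = 0` are `z m = m · a √(2/3)`. [folklore] -/
theorem height_eq_mul_of_isFccData {e : LData} (hz0 : e.2.2.2 0 = 0) (hf : IsFccData e) (m : ℤ) :
    e.2.2.2 m = m * (e.2.1 * Real.sqrt (2 / 3)) := by
  induction m using Int.induction_on with
  | zero => simp [hz0]
  | succ n ih =>
    have h := hf.2 (n : ℤ)
    push_cast at ih ⊢
    linarith
  | pred n ih =>
    have h := hf.2 (-(n : ℤ) - 1)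
    rw [sub_add_cancel] at h
    push_cast at ih ⊢
    linarith

/-- **The competitor energy of ideal fcc data is at least `2e*`** (registered sub-goal
`lms_competitor_ge_of_fcc`): the restacked data `(a, alternatingHagg, z)` of ideal fcc data present the
hcp crystal `hcpStacking a (a√(2/3))`, whose root energy is `e(hcp a h) ≥ e*`. [folklore] -/
theorem lms_competitor_ge_of_fcc : ∀ (e : LData), IsNormalData e → IsFccData e → 2 * eStar ≤ inLayerInteraction lennardJones e.2.1 + ∑' m : ℤ, if m = 0 then (0 : ℝ) else layerInteraction lennardJones e.2.1 (e.2.2.2 m) (haggLabel alternatingHagg m) 1 := by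
  intro e he hf
  obtain ⟨-, hadm, hz0⟩ := he
  have hadm' : IsAdmissibleLayering e.2.1 alternatingHagg e.2.2.2 :=
    ⟨hadm.1, hadm.2.1, isHaggSeq_alternating, hadm.2.2.2⟩
  have ha0 : (0 : ℝ) < e.2.1 := by linarith [hadm.1]
  have ha : e.2.1 ≠ 0 := ha0.ne'
  have hh0 : (0 : ℝ) < e.2.1 * Real.sqrt (2 / 3) := mul_pos ha0 (Real.sqrt_pos.2 (by norm_num))
  have hh : e.2.1 * Real.sqrt (2 / 3) ≠ 0 := hh0.ne'
  have hz : ∀ m : ℤ, e.2.2.2 m = m * (e.2.1 * Real.sqrt (2 / 3)) := height_eq_mul_of_isFccData hz0 hf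
  rw [← two_mul_rootEnergy_eq (A := LinearIsometry.id) hadm' hz0,
    layeredSet_eq_image LinearIsometry.id (fun _ => rfl) hz]
  have himg : ((LinearIsometry.id : E3 →ₗᵢ[ℝ] E3) : E3 → E3) '' hcpStacking e.2.1 (e.2.1 * Real.sqrt (2 / 3)) =
      hcpStacking e.2.1 (e.2.1 * Real.sqrt (2 / 3)) := by
    rw [LinearIsometry.coe_id, Set.image_id]
  rw [himg, rootEnergy_hcpStacking ha hh]
  have hge : eStar ≤ (hcpPeriodicConfiguration ha hh).energyPerParticle lennardJones :=
    ChargedEnergyGapNegative.eStar_le _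
  linarith

end Summit.AtomisticToContinuum.Crystallization.Theorems.SlackRigidityPricedFloorsFaultIdent

end
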